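import Mathlib.CategoryTheory.Groupoid
import Mathlib.CategoryTheory.NatIso
import Mathlib.CategoryTheory.Endomorphism
import Mathlib.CategoryTheory.Conj
import Mathlib.GroupTheory.Torsion
import Mathlib.GroupTheory.QuotientGroup.Defs
import Mathlib.Data.Set.Image
import Literature.IUT.LogThetaLattice.PrimeStripFrame
import HarnessLib

/-!
# [IUTchIII] Proposition 2.1, Theorem 2.2, Remark 2.1.1, Corollary 2.3 (iii)(iv): vertically coric theta monoids and their Kummer theory

Mochizuki, *Inter-universal Teichmüller Theory III*, kurims manuscript (May 2020), §2, pp. 58–75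
(D-0012 claim key, status disputed; every decl carries `[claim: Mochizuki2012, status: disputed]`; typed
over interfaces; the two group-theoretic lemmas proved are classical and take no side).

Printed text (abridged; each decl quotes its own item).
* Prop 2.1 (i) p.58 (Vertically Coric Theta Monoids): "functorial algorithms in the `D`- and
  `D^⊢`-prime-strips `†D_>`, `†D^⊢_>` … for constructing collections of data indexed by `V̲`
  `v ↦ Ψ_{env}(†D_>)_v`; `v ↦ _∞Ψ_{env}(†D_>)_v` as well as a global realified Frobenioid `D^⊩_{env}(†D^⊢_>)`
  equipped with a bijection `Prime(−) ⥲ V̲` and … local isomorphisms … [IUTchII, Cor 4.5 (v)]. In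
  particular, each isomorphism of the full poly-isomorphism induced … by a vertical arrow of the Gaussian
  log-theta-lattice … induces a compatible collection of isomorphisms `Ψ_{env}(^{n,m}D_>) ⥲ Ψ_{env}(^{n,m+1}D_>)`
  …".
* Prop 2.1 (ii) p.59 (Kummer Isomorphisms): functorial algorithms in `†HT` for `Ψ_{F_{env}}(†HT^Θ)_v`,
  `_∞Ψ_{F_{env}}(†HT^Θ)_v`, `C^⊩_{env}(†HT^Θ)` and "Kummer isomorphisms `Ψ_{F_{env}}(†HT^Θ) ⥲ Ψ_{env}(†D_>)` …
  `C^⊩_{env}(†HT^Θ) ⥲ D^⊩_{env}(†D^⊢_>)`"; the strips `F^⊢_{env}(†D_>)`, `F^⊩_{env}(†D_>)` and "isomorphisms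
  `†F^⊢_{env} ⥲ F^⊢_{env}(†D_>)`; `†F^⊩_{env} ⥲ F^⊩_{env}(†D_>)`".
* Prop 2.1 (iii) pp.59–60 (Kummer Theory at Bad Primes), last sentence: "the composite map
  `Π_μ(M^Θ_*(†D_{>,v})) ⊗ ℚ/ℤ → (Ψ_{†F^Θ_v})^{×μ}` obtained by composing … with the natural inclusion … ↪
  `(Ψ_{†F^Θ_v})^×` and the natural projection `(Ψ_{†F^Θ_v})^× ↠ (Ψ_{†F^Θ_v})^{×μ}` is equal to the zero map."
  [`(−)^{×μ} := (−)^×/(−)^μ`, `(−)^μ` = torsion subgroup — IUTchII Ex 1.8 / Thm 2.2 (ii) p.66.]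
* Prop 2.1 (iv)/(v) p.60: the unit portions at good / archimedean primes are "labeled versions" of
  [IUTchII] Prop 4.2 (i),(ii),(iv) / 4.4 (i),(ii),(iv). (vi) pp.60–61: "natural isomorphisms
  `†F^{⊢×}_△ ⥲ †F^{⊢×}_{env}`; `F^{⊢×}_△(†D^⊢_△) ⥲ F^{⊢×}_{env}(†D_>)` … compatible with the Kummer isomorphisms of
  (ii) above and Theorem 1.5, (iii)."
* Rmk 2.1.1 p.61: the five "main properties of mono-theta environments established in [EtTh]":
  "(a) cyclotomic rigidity (b) discrete rigidity (c) constant multiple rigidity (d) isomorphism class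
  compatibility (e) Frobenioid structure compatibility".
* Thm 2.2 (i) p.65 (Automorphisms of Prime-strips): "natural homomorphisms
  `Aut_{F^⊩}(F^⊩_{env}(†D_>)) → Aut_{F^{⊩▶×μ}}(F^{⊩▶×μ}_{env}(†D_>)) ↠ Aut_{F^{⊢×μ}}(F^{⊢×μ}_△(†D^⊢_△))` [and the
  Frobenius-like line] — where the second arrows in each line are surjections — that are compatible
  with the Kummer isomorphisms of Proposition 2.1, (ii), and Theorem 1.5, (iii)".
* Thm 2.2 (ii) pp.65–66 (Kummer Aspects of Multiradiality at Bad Primes): the commutative diagram of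
  splittings/units/`×μ`-quotients; "each of the various composite maps `_∞Ψ_{env}(†D_>)^μ_v →
  Ψ^{ss}_{cns}(†F^⊢_△)^{×μ}_v` is equal to the zero map"; the data (a_v)–(d_v) are "compatible … with …
  arbitrary automorphisms ∈ `Aut_{F^{⊢×μ}}(†F^{⊢×μ}_△)`".
* Cor 2.3 (iii)/(iv) p.75: the poly-isomorphisms of (e_ℜ), (b_{Morℜ}), (d_{Morℜ}) and the algorithmic
  constructions of Prop 2.1 / Thm 2.2 / Thm 1.5 are compatible with (stabilized / equivariant /
  functorial with respect to arbitrary automorphisms of the domain and codomain of) the horizontal arrows.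

Typing. INTERFACE `ThetaMonoidData` (owners abc-iut-L6-t1/t2 for [IUTchII] Cor 4.5 (iv)(v), 4.6 (iv)(v),
4.10 (ii), Prop 3.1–3.4, TODO-merge): target categories `TM` ("collections of data indexed by `V̲`" of
theta monoids with their Galois actions and splittings) and `RF` (global realified Frobenioids with
`Prime ⥲ V̲` and local isomorphisms), the étale-like functors out of `D`/`DHT`, the Frobenius-like functors
out of `HT`, the Kummer natural isomorphisms, the strips and Thm 2.2 (i)'s surjectivity. PROVED (Mathlib
group theory): `torsion_comp_mkTorsionQuotient` — a homomorphism from a torsion group into `A^×` composed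
with `A^× ↠ A^{×μ} = A^×/A^μ` is trivial — which IS the "zero map" sentences of Prop 2.1 (iii) and Thm 2.2 (ii)
once `Π_μ ⊗ ℚ/ℤ` (resp. `_∞Ψ^μ`) is torsion; Thm 2.2 (i)'s homomorphisms as `Functor.mapAut` composed with
`Iso.conjAut` (DEFINED), vertical-coricity transport of Prop 2.1 (i) (DEFINED, full by Thm 1.5 (i)).
Deliberately NOT typed (expository / philosophy, named for the census): Rmk 2.1.1 (i)–(v) beyond the list
(a)–(e); Rmk 2.1.2 (i), (ii) (incl. `N_{Π̂}(Π^†)/Π^† ≅ Ẑ/ℤ`, a tempered-π₁ fact for abc-iut-L3); Rmk 2.2.1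
(i)–(iv) (Figs. 2.1–2.2); Rmk 2.2.2 (i)–(iii) (Fig. 2.3; "`q ↦ q^λ`"); Rmk 2.3.1 (i)–(iii); Rmk 2.3.2; Rmk
2.3.3 (i)–(v), (ix), (x) (Fig. 2.7; (vi)–(viii) are `RemarksArithmetic.lean`); Rmk 2.3.4 (i)–(iv).
-/

namespace Literature.IUT.LogThetaLattice

open CategoryTheory
open Literature.IUT.HodgeTheaters

universe u

/-! ### The group-theoretic lemma behind the "zero map" sentences -/

/-- **IUTchIII:Prop2.1(iii)** (kurims p.60) "… is equal to the zero map" — the mechanism: a homomorphism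
`f : T → Aˣ` from a TORSION group `T` (e.g. `Π_μ ⊗ ℚ/ℤ ≅ ℚ/ℤ`, or a torsion subgroup `(−)^μ`) composed with
the projection `Aˣ ↠ A^{×μ} := Aˣ/(torsion)` is trivial, since `f` lands in the torsion subgroup.
[claim: Mochizuki2012, status: disputed] -/
theorem torsion_comp_mkTorsionQuotient {T A : Type*} [CommGroup T] [CommGroup A] (hT : Monoid.IsTorsion T)
    (f : T →* A) : (QuotientGroup.mk' (CommGroup.torsion A)).comp f = 1 := by
  ext t
  simp only [MonoidHom.coe_comp, Function.comp_apply, QuotientGroup.coe_mk', MonoidHom.one_apply,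
    QuotientGroup.eq_one_iff]
  exact f.isOfFinOrder (hT t)

/-- **IUTchIII:Thm2.2(ii)** (kurims p.66) the same for a torsion SUBGROUP: "each of the various composite
maps `_∞Ψ_{env}(†D_>)^μ_v → Ψ^{ss}_{cns}(†F^⊢_△)^{×μ}_v` is equal to the zero map" — a homomorphism out of the torsion
subgroup `B^μ` of `B` into `A`, followed by `A ↠ A/A^μ`, is trivial. [claim: Mochizuki2012, status: disputed] -/
theorem torsionSubgroup_comp_mkTorsionQuotient {B A : Type*} [CommGroup B] [CommGroup A]
    (f : CommGroup.torsion B →* A) : (QuotientGroup.mk' (CommGroup.torsion A)).comp f = 1 := by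
  refine torsion_comp_mkTorsionQuotient (fun x => ?_) f
  have hx : IsOfFinOrder (x : B) := x.2
  obtain ⟨n, hn, hxn⟩ := (isOfFinOrder_iff_pow_eq_one).mp hx
  exact (isOfFinOrder_iff_pow_eq_one).mpr ⟨n, hn, Subtype.ext (by simpa using hxn)⟩

/-! ### Rmk 2.1.1: the five rigidity / compatibility properties of mono-theta environments -/

/-- **IUTchIII:Rmk2.1.1(i)** (kurims p.61) "the main properties of mono-theta environments established in
[EtTh] … namely, (a) cyclotomic rigidity (b) discrete rigidity (c) constant multiple rigidity (d)
isomorphism class compatibility (e) Frobenioid structure compatibility". [claim: Mochizuki2012, status: disputed] -/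
inductive MonoThetaRigidity : Type
  /-- (a) cyclotomic rigidity [EtTh, Cor 2.19 (i)] -/
  | cyclotomic
  /-- (b) discrete rigidity [EtTh, Cor 2.19 (ii)] -/
  | discrete
  /-- (c) constant multiple rigidity [EtTh, Cor 2.19 (iii)] -/
  | constantMultiple
  /-- (d) isomorphism class compatibility [EtTh, Cor 5.12, Rmks 5.12.1–2] -/
  | isoClassCompat
  /-- (e) Frobenioid structure compatibility -/
  | frobenioidStructureCompat
  deriving DecidableEq

/-! ### The interface for Prop 2.1 / Thm 2.2 -/

/-- **STUB for IUTchII:Cor4.5(iv)(v) / Cor4.6(iv)(v) / Cor4.10(ii)** TODO-merge:abc-iut-L6-t2 (and L6-t1 for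
the mono-theta environments of [IUTchII] §1–§3) — (kurims pp.58–61, 65–66) the data Prop 2.1 and Thm 2.2
quote: target categories of "collections of data indexed by `V̲`" of theta monoids (`TM`) and of global
realified Frobenioids with `Prime ⥲ V̲` and local isomorphisms (`RF`); the étale-like functorial algorithms
in `†D_>` / `†D^⊢_>` / `†HT^D` and the Frobenius-like ones in `†HT`; the Kummer isomorphisms; the strips
`F^⊩_{env}(†D_>)`, `F^{⊩▶×μ}_{env}(†D_>)`, `F^{⊢×μ}_△(†D^⊢_△)`; Thm 2.2 (i)'s surjectivity. [claim: Mochizuki2012, status: disputed] -/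
structure ThetaMonoidData (S : StripFrame.{u}) where
  /-- category of collections `{Ψ_v}_{v∈V̲}` of theta monoids with Galois actions [IUTchII, Cor 4.5 (iv)] -/
  TM : Type u
  [catTM : Category.{u} TM]
  /-- category of data `(C^⊩, Prime(C^⊩) ⥲ V̲, local isomorphisms)` [IUTchII, Cor 4.5 (v)] -/
  RF : Type u
  [catRF : Category.{u} RF]
  /-- the label `>` among the bridge labels of the frame [IUTchI, Def 5.5 (ii)] -/
  gt : S.Label
  /-- Prop 2.1 (i): `†D_> ↦ Ψ_{env}(†D_>)` [IUTchII, Cor 4.5 (iv)] -/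
  ΨenvD : S.D ⥤ TM
  /-- Prop 2.1 (i): `†D_> ↦ _∞Ψ_{env}(†D_>)` -/
  ΨenvInfD : S.D ⥤ TM
  /-- Prop 2.1 (i): `†D^⊢_> ↦ D^⊩_{env}(†D^⊢_>)` [IUTchII, Cor 4.5 (v)] -/
  DglEnv : S.Dv ⥤ RF
  /-- Prop 2.1 (ii): `†HT ↦ Ψ_{F_{env}}(†HT^Θ)` (Frobenius-like) [IUTchII, Cor 4.6 (iv)] -/
  ΨFenv : S.HT ⥤ TM
  /-- Prop 2.1 (ii): `†HT ↦ _∞Ψ_{F_{env}}(†HT^Θ)` -/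
  ΨFenvInf : S.HT ⥤ TM
  /-- Prop 2.1 (ii): `†HT ↦ C^⊩_{env}(†HT^Θ)` [IUTchII, Cor 4.6 (v)] -/
  CglEnv : S.HT ⥤ RF
  /-- Prop 2.1 (ii): the Kummer isomorphism `Ψ_{F_{env}}(†HT^Θ) ⥲ Ψ_{env}(†D_>)`, functorial in `†HT` -/
  kummerΨ : ΨFenv ≅ (S.htToD ⋙ S.dstrip gt) ⋙ ΨenvD
  /-- Prop 2.1 (ii): the Kummer isomorphism `_∞Ψ_{F_{env}}(†HT^Θ) ⥲ _∞Ψ_{env}(†D_>)` -/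
  kummerΨInf : ΨFenvInf ≅ (S.htToD ⋙ S.dstrip gt) ⋙ ΨenvInfD
  /-- Prop 2.1 (ii): the Kummer isomorphism `C^⊩_{env}(†HT^Θ) ⥲ D^⊩_{env}(†D^⊢_>)` -/
  kummerC : CglEnv ≅ ((S.htToD ⋙ S.dstrip gt) ⋙ S.DToDv) ⋙ DglEnv
  /-- Prop 2.1 (ii): `†D_> ↦ F^⊩_{env}(†D_>)`, the `F^⊩`-prime-strip determined by `Ψ_{env}`, `D^⊩_{env}` -/
  FglEnvD : S.D ⥤ S.Fgl
  /-- [IUTchII] Cor 4.10 (ii): `†HT ↦ †F^⊩_{env}` (Frobenius-like) -/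
  FglEnvHT : S.HT ⥤ S.Fgl
  /-- Prop 2.1 (ii), last display: "`†F^⊩_{env} ⥲ F^⊩_{env}(†D_>)`", functorial in `†HT` -/
  kummerFgl : FglEnvHT ≅ (S.htToD ⋙ S.dstrip gt) ⋙ FglEnvD
  /-- Thm 1.5 (iii) / Prop 2.1 (vi): `†HT^D ↦ †D^⊢_△ ↦ F^{⊢×μ}_△(†D^⊢_△)` (as in `ThetaCoricData.fxmDelta`) -/
  fxmDeltaD : S.DHT ⥤ S.Fxm
  /-- Prop 2.1 (vi): "natural isomorphisms … `F^{⊢×}_△(†D^⊢_△) ⥲ F^{⊢×}_{env}(†D_>)`" on associated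
  `F^{⊢×μ}`-prime-strips, functorial in `†HT^D` -/
  unitPortionD : fxmDeltaD ≅ S.dstrip gt ⋙ FglEnvD ⋙ S.FglToFglxm ⋙ S.FglxmToFxm
  /-- Thm 2.2 (i): "the second arrows in each line are surjections" — `Aut(F^{⊩▶×μ}) → Aut(F^{⊢×μ})` -/
  mapAut_surjective : ∀ X : S.Fglxm, Function.Surjective (S.FglxmToFxm.mapAut X)

attribute [instance] ThetaMonoidData.catTM ThetaMonoidData.catRF

namespace ThetaMonoidData

variable {S : StripFrame.{u}} (T : ThetaMonoidData S)

/-! ### Prop 2.1 (i): vertical coricity transport -/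

/-- **IUTchIII:Prop2.1(i)** (kurims p.58) `†HT^D ↦ †D_>`, the `D`-prime-strip labelled `>`. [claim: Mochizuki2012, status: disputed] -/
abbrev Dgt : S.DHT ⥤ S.D := S.dstrip T.gt

/-- **IUTchIII:Prop2.1(i)** (kurims p.58) "each isomorphism of the full poly-isomorphism induced … by a
vertical arrow … induces a compatible collection of isomorphisms `Ψ_{env}(^{n,m}D_>) ⥲ Ψ_{env}(^{n,m+1}D_>)`":
the induced poly-isomorphism along `†HT^D ↦ †D_> ↦ Ψ_{env}(†D_>)` (for the vertical arrows, from the FULL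
poly-isomorphism of `D`-Hodge theaters, Thm 1.5 (i)). [claim: Mochizuki2012, status: disputed] -/
def verticalΨenv (H H' : S.DHT) : PolyIso ((T.Dgt ⋙ T.ΨenvD).obj H) ((T.Dgt ⋙ T.ΨenvD).obj H') :=
  (PolyIso.full H H').map (T.Dgt ⋙ T.ΨenvD)

/-- **IUTchIII:Prop2.1(i)** (kurims p.58) … and `D^⊩_{env}(^{n,m}D^⊢_>) ⥲ D^⊩_{env}(^{n,m+1}D^⊢_>)`, "compatible with
the respective bijections involving "`Prime(−)`" [and] local isomorphisms" (compatibility is built into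
the morphisms of `RF`). [claim: Mochizuki2012, status: disputed] -/
def verticalDglEnv (H H' : S.DHT) :
    PolyIso ((T.Dgt ⋙ S.DToDv ⋙ T.DglEnv).obj H) ((T.Dgt ⋙ S.DToDv ⋙ T.DglEnv).obj H') :=
  (PolyIso.full H H').map (T.Dgt ⋙ S.DToDv ⋙ T.DglEnv)

/-- **IUTchIII:Prop2.1(i)** (kurims p.58) the induced poly-isomorphisms are nonempty. [claim: Mochizuki2012, status: disputed] -/
theorem verticalΨenv_nonempty (H H' : S.DHT) : (T.verticalΨenv H H').Nonempty :=
  (S.full_nonempty_DHT H H').image _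

/-! ### Prop 2.1 (ii): Kummer isomorphisms at one Hodge theater -/

/-- **IUTchIII:Prop2.1(ii)** (kurims p.59) the Kummer isomorphism `Ψ_{F_{env}}(†HT^Θ) ⥲ Ψ_{env}(†D_>)` at `†HT`.
[claim: Mochizuki2012, status: disputed] -/
def kummerΨAt (X : S.HT) : T.ΨFenv.obj X ≅ T.ΨenvD.obj (T.Dgt.obj (S.htToD.obj X)) := T.kummerΨ.app X

/-- **IUTchIII:Prop2.1(ii)** (kurims p.59) the Kummer isomorphism `C^⊩_{env}(†HT^Θ) ⥲ D^⊩_{env}(†D^⊢_>)` at `†HT`.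
[claim: Mochizuki2012, status: disputed] -/
def kummerCAt (X : S.HT) :
    T.CglEnv.obj X ≅ T.DglEnv.obj (S.DToDv.obj (T.Dgt.obj (S.htToD.obj X))) := T.kummerC.app X

/-- **IUTchIII:Prop2.1(ii)** (kurims p.59) "`†F^⊩_{env} ⥲ F^⊩_{env}(†D_>)`" at `†HT`. [claim: Mochizuki2012, status: disputed] -/
def kummerFglAt (X : S.HT) : T.FglEnvHT.obj X ≅ T.FglEnvD.obj (T.Dgt.obj (S.htToD.obj X)) :=
  T.kummerFgl.app X

/-- **IUTchIII:Prop2.1(ii)** (kurims p.59) Kummer isomorphisms are compatible with isomorphisms of Hodge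
theaters (naturality): for `ξ : †HT ⥲ ‡HT` the Frobenius-like isomorphism and the étale-like one induced by
`D(ξ)` correspond. [claim: Mochizuki2012, status: disputed] -/
theorem kummerΨ_naturality {X Y : S.HT} (ξ : X ⟶ Y) :
    T.ΨFenv.map ξ ≫ (T.kummerΨAt Y).hom = (T.kummerΨAt X).hom ≫ T.ΨenvD.map (T.Dgt.map (S.htToD.map ξ)) :=
  T.kummerΨ.hom.naturality ξ

/-! ### Thm 2.2 (i): the homomorphisms of automorphism groups -/

/-- **IUTchIII:Thm2.2(i)** (kurims p.65) `F^{⊩▶×μ}_{env}(†D_>)`, the `F^{⊩▶×μ}`-prime-strip associated to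
`F^⊩_{env}(†D_>)` [IUTchII, Def 4.9 (viii)]. [claim: Mochizuki2012, status: disputed] -/
abbrev FglxmEnvD : S.D ⥤ S.Fglxm := T.FglEnvD ⋙ S.FglToFglxm

/-- **IUTchIII:Thm2.2(i)** (kurims p.65) the first homomorphism
`Aut_{F^⊩}(F^⊩_{env}(†D_>)) → Aut_{F^{⊩▶×μ}}(F^{⊩▶×μ}_{env}(†D_>))` ("the natural functor … assigning to an
`F^⊩`-prime-strip the associated `F^{⊩▶×μ}`-prime-strip"). [claim: Mochizuki2012, status: disputed] -/
def autToFglxm (D : S.D) : Aut (T.FglEnvD.obj D) →* Aut (T.FglxmEnvD.obj D) :=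
  S.FglToFglxm.mapAut (T.FglEnvD.obj D)

/-- **IUTchIII:Thm2.2(i)** (kurims p.65) the second homomorphism
`Aut_{F^{⊩▶×μ}}(F^{⊩▶×μ}_{env}(†D_>)) ↠ Aut_{F^{⊢×μ}}(F^{⊢×μ}_△(†D^⊢_△))` ("… and then composing with the natural
isomorphisms of Proposition 2.1, (vi)"), at the `D`-Hodge theater `H` with `†D_> = D_>(H)`.
[claim: Mochizuki2012, status: disputed] -/
noncomputable def autToFxmDelta (H : S.DHT) :
    Aut (T.FglxmEnvD.obj (T.Dgt.obj H)) →* Aut (T.fxmDeltaD.obj H) :=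
  (Iso.conjAut (T.unitPortionD.app H).symm).toMonoidHom.comp (S.FglxmToFxm.mapAut _)

/-- **IUTchIII:Thm2.2(i)** (kurims p.65) "where the second arrows in each line are surjections".
[claim: Mochizuki2012, status: disputed] -/
theorem autToFxmDelta_surjective (H : S.DHT) : Function.Surjective (T.autToFxmDelta H) := by
  intro b
  obtain ⟨a, ha⟩ := T.mapAut_surjective _ ((Iso.conjAut (T.unitPortionD.app H).symm).symm b)
  exact ⟨a, (congrArg (Iso.conjAut (T.unitPortionD.app H).symm) ha).trans (MulEquiv.apply_symm_apply _ b)⟩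

/-- **IUTchIII:Thm2.2(i)** (kurims p.65) the Frobenius-like line
`Aut_{F^⊩}(†F^⊩_{env}) → Aut_{F^{⊩▶×μ}}(†F^{⊩▶×μ}_{env})`. [claim: Mochizuki2012, status: disputed] -/
def autToFglxmHT (X : S.HT) : Aut (T.FglEnvHT.obj X) →* Aut ((T.FglEnvHT ⋙ S.FglToFglxm).obj X) :=
  S.FglToFglxm.mapAut (T.FglEnvHT.obj X)

/-- **IUTchIII:Thm2.2(i)** (kurims p.65) "compatible with the Kummer isomorphisms of Proposition 2.1, (ii)":
transporting an automorphism of `†F^⊩_{env}` along the Kummer isomorphism and then passing to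
`F^{⊩▶×μ}` = passing to `F^{⊩▶×μ}` and then transporting (functoriality of `F^⊩ ↦ F^{⊩▶×μ}`).
[claim: Mochizuki2012, status: disputed] -/
theorem autToFglxm_kummer (X : S.HT) (a : Aut (T.FglEnvHT.obj X)) :
    T.autToFglxm _ (Iso.conjAut (T.kummerFglAt X) a) =
      Iso.conjAut (S.FglToFglxm.mapIso (T.kummerFglAt X)) (T.autToFglxmHT X a) := by
  rw [Iso.conjAut_apply, Iso.conjAut_apply]
  show S.FglToFglxm.mapIso (_ ≪≫ a ≪≫ _) = _ ≪≫ S.FglToFglxm.mapIso a ≪≫ _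
  rw [Functor.mapIso_trans, Functor.mapIso_trans, Functor.mapIso_symm]

/-! ### Cor 2.3 (iii): compatibility of the `F^{⊢×μ}`-poly-isomorphisms with the horizontal arrows -/

/-- **IUTchIII:Cor2.3(iii)** (kurims p.75) the (e_ℜ) full poly-isomorphism
`F^{⊢×μ}_{env}(†D_>) ⥲ F^{⊢×μ}_△(†D^⊢_△)` transported along the Kummer isomorphism `†F^{⊢×μ}_{env} ⥲ F^{⊢×μ}_{env}(†D_>)`
(from `kummerFgl`) and followed by any poly-isomorphism induced by a horizontal arrow (FULL, Thm 1.5 (ii))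
is again the full poly-isomorphism — "compatible … with the poly-isomorphisms … of Theorem 1.5, (ii)".
[claim: Mochizuki2012, status: disputed] -/
theorem cor23iii_full (X : S.HT) (H' : S.DHT) :
    ((PolyIso.single ((S.FglToFglxm ⋙ S.FglxmToFxm).mapIso (T.kummerFglAt X))).comp
        (PolyIso.full ((S.FglToFglxm ⋙ S.FglxmToFxm).obj (T.FglEnvD.obj (T.Dgt.obj (S.htToD.obj X))))
          (T.fxmDeltaD.obj (S.htToD.obj X)))).comp
      (PolyIso.full (T.fxmDeltaD.obj (S.htToD.obj X)) (T.fxmDeltaD.obj H')) =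
    PolyIso.full _ _ := by
  rw [PolyIso.comp_full_of_nonempty (P := PolyIso.single _) ⟨_, rfl⟩,
    PolyIso.full_comp_of_nonempty (Q := PolyIso.full _ _)
      ⟨T.fxmDeltaD.mapIso (S.iso_nonempty_DHT _ _).some, PolyIso.mem_full _⟩]

/-- **IUTchIII:Cor2.3(iv)** (kurims p.75) "these constructions are stabilized/equivariant/functorial with
respect to arbitrary automorphisms of the domain and codomain of these horizontal arrows": the étale-like
constructions are FUNCTORS out of `D`-Hodge theaters, hence equivariant for every automorphism `α` — e.g.
the Kummer-transported theta monoid: `Ψ_{env}(D_>(α))` acts compatibly. Recorded as functoriality.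
[claim: Mochizuki2012, status: disputed] -/
theorem cor23iv_equivariant (H : S.DHT) (α β : Aut H) :
    (T.Dgt ⋙ T.ΨenvD).mapIso (α ≪≫ β) = (T.Dgt ⋙ T.ΨenvD).mapIso α ≪≫ (T.Dgt ⋙ T.ΨenvD).mapIso β :=
  Functor.mapIso_trans _ _ _

end ThetaMonoidData

end Literature.IUT.LogThetaLattice
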